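import Summits.ValiantsHypothesis.ValiantsHypothesis.Theses.StableRankCancellation

/-!
# ValiantsHypothesis / StableRankCancellation — item `Assembly` (stmt-ValiantsHypothesis-10615), closed

The assembly item of route `StableRankCancellation` is literally the type of the route's deciding theorem
`Theses.StableRankCancellation.closes` (MinCutStableRankBound → DesignFlat → DesignInVNP → Escalation → ValiantsHypothesis); it is proved by `closes` itself. HONEST FRAMING: bookkeeping; the
hypotheses are OPEN cruxes; nothing here is progress on `VP ≠ VNP`.
-/

-- layout Summits/ValiantsHypothesis/ValiantsHypothesis forces the duplicated namespace component
set_option linter.dupNamespace false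

namespace Summit.ValiantsHypothesis.ValiantsHypothesis.Theorems.StableRankCancellation

/-- **Item `Assembly` (stmt-ValiantsHypothesis-10615):** MinCutStableRankBound → DesignFlat → DesignInVNP → Escalation → ValiantsHypothesis — the route's deciding theorem `closes`. [folklore] -/
theorem assembly_proof : Theses.StableRankCancellation.Assembly := by
  unfold Theses.StableRankCancellation.Assembly
  exact fun hM hF hV hE => Theses.StableRankCancellation.closes hM hF hV hE

end Summit.ValiantsHypothesis.ValiantsHypothesis.Theorems.StableRankCancellation
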